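import Literature.MathematicalPhysics.QuantumFieldTheory.Balaban1983to89.T4RelativeCombFactorisedPatch

/-!
# `Balaban1983to89.T4BlockwiseCombGauge` — the BLOCK-WISE relative comb gauge on all of `ℤ^d`: every bond of the
# lattice controlled by the curvature sups and ONE free number per (block, direction) = the COARSE relative deviation

CITATION HEADER (lean-in-tree rule 2026-08-18).  Kernel certificate, on the CONCRETE `ℤ^d` carriers of `T4RelativeComb`,
of the LATTICE-WIDE ASSEMBLY of this lineage's two-block statement (audit cell `pub-balaban`, T4-DAG v18 carved row
`T4-O3.E-NE1′-OG1′-RESID°`, the part "patching across blocks" (O2b); self-row `T4-O3.E-NE1′-OG1′-LATTICE*` of unit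
`b2b-balaban-pv04` gen 14).  `T4RelativeCombCrossing.two_block_bound_comb` controls, for a unitary-like pair `(U₀, U₁)`,
every bond of TWO neighbouring blocks `B(y) ∪ B(y + Le_μ)` in the patched relative comb gauge by
`crossConst d L·(q₁ + q₀) + X`, `X` the relative deviation of the ONE corner crossing bond `b₀(y, μ) = ⟨y + (L−1)e_μ,
y + Le_μ⟩`.  Here the lattice `ℤ^d` is tiled by the blocks `B(y)`, `y ∈ Lℤ^d` (`corner L x = L·⌊x/L⌋` coordinatewise,
`IsCorner`), the gauge is the BLOCK-WISE relative comb gauge `blockComb L U₀ U₁ x = combGauge U₀ U₁ (corner L x) x`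
(§2; unitary-like; on each pair of neighbouring blocks it IS the patched gauge of `T4RelativeCombCrossing`,
`blockComb_eq_patchGauge`; relative axial gauge holds in EVERY block, `treeRel_blockComb`), and since every bond
`⟨x, x + e_ν⟩` of `ℤ^d` lies in the pair `(B(corner x), B(corner x + Le_ν))` (`inPair_succ`), THE LATTICE BOUND follows
(§3 `bond_bound_blockComb`: each bond by the curvature sups on ITS pair and the corner crossing bond of ITS pair;
`lattice_bound_blockComb`: `‖(U₁^g)(b)·U₀(b)⁻¹ − 1‖ ≤ crossConst d L·(q₁ + q₀) + X` for EVERY bond `b` of `ℤ^d`, from GLOBAL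
curvature sups `q₁, q₀` and `X = sup` over the corner crossing bonds `b₀(y, ν)`, `y ∈ Lℤ^d`, `ν`); §3b IDENTIFIES the
free number: the corner crossing bond in the block-wise gauge is a unitary conjugate of the COARSE relative bond variable
`U₁⁽ᴸ⁾⟨y,ν⟩·U₀⁽ᴸ⁾⟨y,ν⟩⁻¹`, `U⁽ᴸ⁾⟨y,ν⟩ = U(Γ_{y, y+Le_ν})` the straight `L`-step transport (`coarse`, `cornerBond_pert_eq`),
so `X(y, ν) = ‖U₁⁽ᴸ⁾⟨y,ν⟩·U₀⁽ᴸ⁾⟨y,ν⟩⁻¹ − 1‖` EXACTLY (`norm_cornerBond_sub_one_eq`) and the lattice bound reads "fine relative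
deviation ≤ crossConst·(curvatures) + COARSE relative deviation" (`lattice_bound_coarse`); and §4 the same for
FACTORISED (complexified) pairs `𝐔ᵢ = Wᵢ ⊙ Uᵢ` by `T4RelativeCombFactorisedPatch.factorised_bound_gauge`
(`factorised_lattice_bound`, `factorised_lattice_bound_coarse`: `≤ M·(n₁·(crossConst d L·(q₁ + q₀) + X) + w +
2·d(L−1)ε·t₀)`, LINEAR).  §5 non-vacuity.

PRINTED STATUS.  NOTHING printed enters any declaration; every declaration is [folklore] and kernel-proved.  CONTEXT: the
printed statement this assembles toward is [Balaban1985RegularSpaces] Lemma 1, pp. 79–80 (quoted verbatim, CONTEXT ONLY,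
in the header of `T4RelativeCombCrossing` from renders read by this seat, GAPS C-pv04g14-1): a configuration on a large
cube, gauge-fixed BLOCK-WISE relative to `V₀` («(R(V₀)V′)(Γ_{y,x}) = 1 for x ∈ B(y)», the first clause of (1.24)), is
controlled bond-wise by the curvatures and — for the corner crossing bonds — by the block AVERAGE condition (the second
clause of (1.24), «|\overline{V′V₀} − V̄₀| < α₁ on Ω₁⁽¹⁾»), the conclusion being (1.25) «|V′ − 1| < 4d²α₀ + α₁ on Ω₁»
(p. 79, render `b2b-balaban-ref1/pages/1985-cmp99-regular-spaces-gauge-fixing/…-p005-x2.png` re-read as an image for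
v1.1); the present file types everything EXCEPT the average condition and (1.25), on the infinite lattice rather than a
cube (a restriction to a union of blocks is the local form `bond_bound_blockComb`).  The cite tags below are the
imported files'.  v1.1 (2026-08-19, DOCFIX, comment-only; every declaration byte-identical to v1 p186068): the two
equation-number / block-label slips of v1's context sentences (XREAD C-pv12g13-12 items D1, D2) corrected here and in
HONEST SCOPE (ii).

HONEST SCOPE.  (i) Sup norms, unitary-like pairs (§3) or factorised pairs with unitary-like parts (§4); hypotheses =
plaquette sups (global in `lattice_bound_blockComb`, pair-local in `bond_bound_blockComb`).  (ii) The numbers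
`X(y, ν) = ‖(U₁^g)(b₀(y,ν))·U₀(b₀(y,ν))⁻¹ − 1‖`, one per block corner and direction, are IDENTIFIED (§3b: the relative
deviation of the straight coarse transports) but NOT BOUNDED — they stay free INPUTS; in print the corresponding numbers
are fixed by the block AVERAGE condition (the second clause of (1.24); the printed coarse variable is the average `V = Ū`,
not the straight transport; `T4RelativeCombCrossing` §7 relates the contour ratios of the average to the crossing bonds); nothing here
bounds them.  (iii) `L ≥ 1` only is needed (for `L = 1` every bond is a corner crossing bond and
the statement is empty of content, honestly).  (iv) NO statement about Bałaban's averages, windows, Hölder norms or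
renormalization transformations.  Value = kernel bookkeeping (Euclidean division on `ℤ^d` + gauge locality + the
two-block theorem BY NAME); NOT summit progress.
-/

namespace Literature.MathematicalPhysics.QuantumFieldTheory.Balaban1983to89.T4BlockwiseCombGauge

open B8Lemma1Lattice (e site InBlock InPair yplus inBlock_site_iff site_add_single)
open T4RelativeLadder (UnitaryLike norm_conj_sub_one_eq)
open T4RelativeComb (Cfg gaugeAct plaq combGauge unitaryLike_combGauge gaugeAct_combGauge_tree norm_combGauge_sub_one_le
  IsTree hol hol_succ unitaryLike_hol relGauge combGauge_site combGauge_corner)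
open T4RelativeCombWindow (fmul)
open T4RelativeCombCrossing (pert TreeRel patchGauge patchGauge_of_left patchGauge_of_right PlaqSupPair crossConst
  two_block_bound_comb)
open T4RelativeCombFactorisedPatch (factorised_bound_gauge)

variable {R : Type*} [NormedRing R] {d : ℕ}

/-- [folklore] Sites of `ℤ^d` (the same carrier as `T4RelativeComb.Site d`, definitionally). -/
abbrev Site (d : ℕ) : Type := Fin d → ℤ

example (d : ℕ) : Site d = T4RelativeComb.Site d := rfl

/-! ## §1  The block lattice `Lℤ^d`: corners by Euclidean division -/

/-- [folklore] The corner of the `L`-block containing `x`: `L·⌊x_i / L⌋` coordinatewise (Euclidean division). -/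
def corner (L : ℕ) (x : Site d) : Site d := fun i => (L : ℤ) * (x i / (L : ℤ))

/-- [folklore] Block corners: the points of `Lℤ^d`. -/
def IsCorner (L : ℕ) (y : Site d) : Prop := ∀ i, (L : ℤ) ∣ y i

/-- [folklore] `corner L x ∈ Lℤ^d`. -/
theorem isCorner_corner (L : ℕ) (x : Site d) : IsCorner L (corner L x) := fun i => ⟨x i / (L : ℤ), rfl⟩

/-- [folklore] `y ∈ Lℤ^d ⇒ y + Le_μ ∈ Lℤ^d`. -/
theorem isCorner_yplus {L : ℕ} {y : Site d} (hy : IsCorner L y) (μ : Fin d) : IsCorner L (yplus L y μ) := by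
  intro i
  obtain ⟨m, hm⟩ := hy i
  by_cases h : i = μ
  · subst h; exact ⟨m + 1, by simp [yplus, site, hm, mul_add]⟩
  · exact ⟨m, by simp [yplus, site, h, hm]⟩

/-- [folklore] `x ∈ B(corner x)` (`0 ≤ x_i mod L < L`). -/
theorem inBlock_corner {L : ℕ} (hL : 1 ≤ L) (x : Site d) : InBlock L (corner L x) x := by
  intro i
  have hL0 : (L : ℤ) ≠ 0 := by exact_mod_cast (show L ≠ 0 by omega)
  have hLp : (0 : ℤ) < L := by exact_mod_cast (show 0 < L by omega)
  have h := Int.mul_ediv_add_emod (x i) (L : ℤ)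
  have h0 := Int.emod_nonneg (x i) hL0
  have h1 := Int.emod_lt_of_pos (x i) hLp
  simp only [corner]
  constructor <;> omega

/-- [folklore] UNIQUENESS: a point of a block with corner in `Lℤ^d` has that corner. -/
theorem corner_eq_of_inBlock {L : ℕ} (hL : 1 ≤ L) {y x : Site d} (hy : IsCorner L y) (hx : InBlock L y x) :
    corner L x = y := by
  funext i
  obtain ⟨m, hm⟩ := hy i
  obtain ⟨h1, h2⟩ := hx i
  have hL0 : (L : ℤ) ≠ 0 := by exact_mod_cast (show L ≠ 0 by omega)
  have hr0 : 0 ≤ x i - L * m := by rw [hm] at h1; linarith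
  have hrL : x i - L * m < L := by rw [hm] at h2; linarith
  have hq : x i / (L : ℤ) = m := by
    have ex : x i = (x i - L * m) + m * L := by ring
    rw [ex, Int.add_mul_ediv_right _ _ hL0, Int.ediv_eq_zero_of_lt hr0 hrL, zero_add]
  show (L : ℤ) * (x i / (L : ℤ)) = y i
  rw [hq, hm]

/-- [folklore] EVERY BOND LIES IN A PAIR OF NEIGHBOURING BLOCKS: `x + e_ν ∈ B(corner x) ∪ B(corner x + Le_ν)`. -/
theorem inPair_succ {L : ℕ} (hL : 1 ≤ L) (x : Site d) (ν : Fin d) : InPair L (corner L x) ν (x + e ν) := by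
  have hx := inBlock_corner hL x
  by_cases hlt : x ν + 1 < corner L x ν + L
  · left
    intro κ
    by_cases hκ : κ = ν
    · subst hκ; have := hx κ; simp only [Pi.add_apply, e, Pi.single_eq_same]; omega
    · have := hx κ; simp only [Pi.add_apply, e, Pi.single_apply, hκ, if_false, add_zero]; exact this
  · right
    intro κ
    by_cases hκ : κ = ν
    · subst hκ
      have := hx κ
      simp only [yplus, site, Pi.add_apply, e, Pi.single_eq_same]
      omega
    · have := hx κ
      simp only [yplus, site, Pi.add_apply, e, Pi.single_apply, hκ, if_false, add_zero, Nat.cast_zero]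
      exact this

/-- [folklore] The left end of a bond lies in the pair trivially. -/
theorem inPair_self {L : ℕ} (hL : 1 ≤ L) (x : Site d) (ν : Fin d) : InPair L (corner L x) ν x :=
  Or.inl (inBlock_corner hL x)

/-- [folklore] The corner crossing bond `b₀(y, ν) = ⟨y + (L−1)e_ν, y + Le_ν⟩` has its left end in `B(y)` … -/
theorem inBlock_cornerBond_left {L : ℕ} (hL : 1 ≤ L) (y : Site d) (ν : Fin d) :
    InBlock L y (site y (Pi.single ν (L - 1))) :=
  (inBlock_site_iff L y _).2 fun κ => by
    by_cases hκ : κ = ν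
    · subst hκ; simp; omega
    · simp [hκ]; omega

/-- [folklore] … and its right end in `B(y + Le_ν)`. -/
theorem inBlock_cornerBond_right {L : ℕ} (hL : 1 ≤ L) (y : Site d) (ν : Fin d) :
    InBlock L (yplus L y ν) (site y (Pi.single ν (L - 1)) + e ν) := by
  intro κ
  by_cases hκ : κ = ν
  · subst hκ
    simp only [yplus, site, Pi.add_apply, e, Pi.single_eq_same]
    constructor <;> omega
  · simp only [yplus, site, Pi.add_apply, e, Pi.single_apply, hκ, if_false, Nat.cast_zero, add_zero]
    constructor <;> omega

/-! ## §2  The block-wise relative comb gauge -/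

/-- [folklore] THE BLOCK-WISE RELATIVE COMB GAUGE of the pair `(U₀, U₁)`: at `x`, the relative comb gauge
(`T4RelativeComb.combGauge`) of the block `B(corner x)` containing `x`. -/
noncomputable def blockComb (L : ℕ) (U₀ U₁ : Cfg d R) : Site d → Rˣ := fun x => combGauge U₀ U₁ (corner L x) x

/-- [folklore] It is unitary-like for a unitary-like pair. -/
theorem unitaryLike_blockComb [NormOneClass R] {U₀ U₁ : Cfg d R} (hU₀ : ∀ x ν, UnitaryLike (U₀ x ν))
    (hU₁ : ∀ x ν, UnitaryLike (U₁ x ν)) (L : ℕ) (x : Site d) : UnitaryLike (blockComb L U₀ U₁ x) :=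
  unitaryLike_combGauge hU₀ hU₁ _ x

/-- [folklore] On a block `B(y)`, `y ∈ Lℤ^d`, the block-wise gauge is the comb gauge of `B(y)`. -/
theorem blockComb_of_inBlock {L : ℕ} (hL : 1 ≤ L) (U₀ U₁ : Cfg d R) {y x : Site d} (hy : IsCorner L y)
    (hx : InBlock L y x) : blockComb L U₀ U₁ x = combGauge U₀ U₁ y x := by
  simp only [blockComb, corner_eq_of_inBlock hL hy hx]

/-- [folklore] LOCALITY: on the pair `B(y) ∪ B(y + Le_μ)`, `y ∈ Lℤ^d`, the block-wise gauge IS the patched gauge of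
`T4RelativeCombCrossing` for that pair. -/
theorem blockComb_eq_patchGauge {L : ℕ} (hL : 1 ≤ L) (U₀ U₁ : Cfg d R) {y : Site d} (hy : IsCorner L y) (μ : Fin d)
    {x : Site d} (hx : InPair L y μ x) : blockComb L U₀ U₁ x = patchGauge L y μ U₀ U₁ x := by
  rcases hx with hx | hx
  · rw [patchGauge_of_left U₀ U₁ hx, blockComb_of_inBlock hL U₀ U₁ hy hx]
  · rw [patchGauge_of_right U₀ U₁ hx, blockComb_of_inBlock hL U₀ U₁ (isCorner_yplus hy μ) hx]

/-- [folklore] Hence on a bond with both ends in the pair the two gauge actions agree. -/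
theorem gaugeAct_blockComb_eq {L : ℕ} (hL : 1 ≤ L) (U₀ U₁ : Cfg d R) {y : Site d} (hy : IsCorner L y) (μ : Fin d)
    {x : Site d} {ν : Fin d} (hx : InPair L y μ x) (hxν : InPair L y μ (x + e ν)) :
    gaugeAct (blockComb L U₀ U₁) U₁ x ν = gaugeAct (patchGauge L y μ U₀ U₁) U₁ x ν := by
  simp only [gaugeAct, blockComb_eq_patchGauge hL U₀ U₁ hy μ hx, blockComb_eq_patchGauge hL U₀ U₁ hy μ hxν]

/-- [folklore] RELATIVE AXIAL GAUGE IN EVERY BLOCK: `(U₀, U₁^g)` satisfies `TreeRel` on `B(y)` for every `y ∈ Lℤ^d`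
(`T4RelativeComb.gaugeAct_combGauge_tree` BY NAME, through locality). -/
theorem treeRel_blockComb {L : ℕ} (hL : 1 ≤ L) {y : Site d} (hy : IsCorner L y) (U₀ U₁ : Cfg d R) :
    TreeRel L y U₀ (gaugeAct (blockComb L U₀ U₁) U₁) := by
  intro k ρ hk hρ ht
  have h1 : InBlock L y (site y k) := (inBlock_site_iff L y k).2 hk
  have h2 : InBlock L y (site y k + e ρ) := by
    rw [← B8Lemma1Lattice.site_add_single]
    exact (inBlock_site_iff L y _).2 (B8Lemma1Lattice.lt_of_add_single hk hρ)
  have e1 : gaugeAct (blockComb L U₀ U₁) U₁ (site y k) ρ = gaugeAct (combGauge U₀ U₁ y) U₁ (site y k) ρ := by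
    simp only [gaugeAct, blockComb_of_inBlock hL U₀ U₁ hy h1, blockComb_of_inBlock hL U₀ U₁ hy h2]
  rw [e1]
  exact gaugeAct_combGauge_tree U₀ U₁ y ht

/-! ## §3  The lattice bound for unitary-like pairs -/

/-- [folklore] THE BOND BOUND, LOCAL FORM: for a unitary-like pair and the bond `b = ⟨x, x + e_ν⟩`, with `y = corner x`
and the pair `P = B(y) ∪ B(y + Le_ν)`: if the curvatures of `U₁`, `U₀` are `≤ q₁`, `≤ q₀` on the plaquettes of `P`, then
in the block-wise comb gauge `‖(U₁^g)(b)·U₀(b)⁻¹ − 1‖ ≤ crossConst d L·(q₁ + q₀) + X(y, ν)`,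
`X(y, ν) = ‖(U₁^g)(b₀)·U₀(b₀)⁻¹ − 1‖` the corner crossing bond of `P` (`two_block_bound_comb` BY NAME + locality). -/
theorem bond_bound_blockComb [NormOneClass R] {U₀ U₁ : Cfg d R} {L : ℕ} {q₁ q₀ : ℝ}
    (hU₀ : ∀ x ν, UnitaryLike (U₀ x ν)) (hU₁ : ∀ x ν, UnitaryLike (U₁ x ν)) (hL : 1 ≤ L) (x : Site d) (ν : Fin d)
    (hq₁ : PlaqSupPair L (corner L x) ν (fun x' ρ κ => ‖(plaq U₁ x' ρ κ : R) - 1‖) q₁)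
    (hq₀ : PlaqSupPair L (corner L x) ν (fun x' ρ κ => ‖(plaq U₀ x' ρ κ : R) - 1‖) q₀) (hq : 0 ≤ q₁ + q₀) :
    ‖(pert U₀ (gaugeAct (blockComb L U₀ U₁) U₁) x ν : R) - 1‖ ≤
      crossConst d L * (q₁ + q₀) +
        ‖(pert U₀ (gaugeAct (blockComb L U₀ U₁) U₁) (site (corner L x) (Pi.single ν (L - 1))) ν : R) - 1‖ := by
  have hy := isCorner_corner L x
  have h := two_block_bound_comb hU₀ hU₁ hL hq₁ hq₀ hq x ν (inPair_self hL x ν) (inPair_succ hL x ν)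
  simp only [pert] at h ⊢
  rwa [gaugeAct_blockComb_eq hL U₀ U₁ hy ν (inPair_self hL x ν) (inPair_succ hL x ν),
    gaugeAct_blockComb_eq hL U₀ U₁ hy ν (Or.inl (inBlock_cornerBond_left hL _ ν))
      (Or.inr (inBlock_cornerBond_right hL _ ν))]

/-- [folklore] **THE LATTICE BOUND**: for a unitary-like pair `(U₀, U₁)` on `ℤ^d` with GLOBAL curvature sups `q₁, q₀`,
the block-wise relative comb gauge `g` (`L ≥ 1`) gives, on EVERY bond `b` of `ℤ^d`,
`‖(U₁^g)(b)·U₀(b)⁻¹ − 1‖ ≤ crossConst d L·(q₁ + q₀) + X`, where `X` bounds the relative deviation on the corner crossing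
bonds `b₀(y, ν) = ⟨y + (L−1)e_ν, y + Le_ν⟩`, `y ∈ Lℤ^d` — one free number per block and direction, fixed in print by the
average condition (NOT here). -/
theorem lattice_bound_blockComb [NormOneClass R] {U₀ U₁ : Cfg d R} {L : ℕ} {q₁ q₀ X : ℝ}
    (hU₀ : ∀ x ν, UnitaryLike (U₀ x ν)) (hU₁ : ∀ x ν, UnitaryLike (U₁ x ν)) (hL : 1 ≤ L)
    (hq₁ : ∀ x ρ κ, ρ ≠ κ → ‖(plaq U₁ x ρ κ : R) - 1‖ ≤ q₁) (hq₀ : ∀ x ρ κ, ρ ≠ κ → ‖(plaq U₀ x ρ κ : R) - 1‖ ≤ q₀)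
    (hq : 0 ≤ q₁ + q₀)
    (hX : ∀ y ν, IsCorner L y →
      ‖(pert U₀ (gaugeAct (blockComb L U₀ U₁) U₁) (site y (Pi.single ν (L - 1))) ν : R) - 1‖ ≤ X)
    (x : Site d) (ν : Fin d) :
    ‖(pert U₀ (gaugeAct (blockComb L U₀ U₁) U₁) x ν : R) - 1‖ ≤ crossConst d L * (q₁ + q₀) + X :=
  (bond_bound_blockComb hU₀ hU₁ hL x ν (fun x' ρ κ h _ _ _ _ => hq₁ x' ρ κ h) (fun x' ρ κ h _ _ _ _ => hq₀ x' ρ κ h)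
    hq).trans (add_le_add le_rfl (hX _ ν (isCorner_corner L x)))

/-! ## §3b  The free number IDENTIFIED: corner crossing bonds are the COARSE relative bond deviations -/

/-- [folklore] A multiple of `e_ν` carries tree bonds in direction `ν` (the straight line from the corner along `e_ν` is
a tree path). -/
theorem isTree_single (ν : Fin d) (j : ℕ) : IsTree (Pi.single ν j : Fin d → ℕ) ν := by
  intro κ hκ
  have hne : κ ≠ ν := fun h => by subst h; exact lt_irrefl _ hκ
  simp [hne]

/-- [folklore] THE STRAIGHT TRANSPORT grows one bond at a time: `U(Γ_{y, y+(j+1)e_ν}) = U(Γ_{y, y+je_ν})·U⟨y+je_ν, ·+e_ν⟩`. -/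
theorem hol_line_succ (U : Cfg d R) (y : Site d) (ν : Fin d) (j : ℕ) :
    hol U y (Pi.single ν (j + 1)) = hol U y (Pi.single ν j) * U (site y (Pi.single ν j)) ν := by
  rw [Pi.single_add]; exact hol_succ U y (isTree_single ν j)

/-- [folklore] THE COARSE CONFIGURATION of scale `L`: the straight parallel transporter over `L` bonds,
`U⁽ᴸ⁾⟨y, ν⟩ := U(Γ_{y, y + Le_ν}) = U⟨y,·⟩·U⟨y+e_ν,·⟩⋯U⟨y+(L−1)e_ν,·⟩` — for `y ∈ Lℤ^d` the variable of the COARSE bond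
`⟨y, y + Le_ν⟩` of the block lattice (CONTEXT: in print the coarse variable attached to a block is the block AVERAGE
`V = Ū` of [Balaban1985Averaging] (44)–(47), not the straight transport; nothing printed is claimed). -/
def coarse (L : ℕ) (U : Cfg d R) : Cfg d R := fun y ν => hol U y (Pi.single ν L)

/-- [folklore] Peeling the last bond: `U⁽ᴸ⁾⟨y,ν⟩ = U(Γ_{y, y+(L−1)e_ν})·U⟨y+(L−1)e_ν, y+Le_ν⟩` — the last factor is the
corner crossing bond `b₀(y, ν)`. -/
theorem coarse_eq {L : ℕ} (hL : 1 ≤ L) (U : Cfg d R) (y : Site d) (ν : Fin d) :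
    coarse L U y ν = hol U y (Pi.single ν (L - 1)) * U (site y (Pi.single ν (L - 1))) ν := by
  have h : L = (L - 1) + 1 := by omega
  show hol U y (Pi.single ν L) = _
  conv_lhs => rw [h]
  exact hol_line_succ U y ν (L - 1)

/-- [folklore] The coarse configuration of a unitary-like configuration is unitary-like. -/
theorem unitaryLike_coarse [NormOneClass R] {U : Cfg d R} (hU : ∀ x ν, UnitaryLike (U x ν)) (L : ℕ) (y : Site d)
    (ν : Fin d) : UnitaryLike (coarse L U y ν) :=
  unitaryLike_hol hU y _

/-- [folklore] A corner lies in its own block. -/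
theorem inBlock_self {L : ℕ} (hL : 1 ≤ L) (y : Site d) : InBlock L y y := fun κ => ⟨le_rfl, by omega⟩

/-- [folklore] The far end of the corner crossing bond is the next corner: `y + (L−1)e_ν + e_ν = y + Le_ν`. -/
theorem cornerBond_succ {L : ℕ} (hL : 1 ≤ L) (y : Site d) (ν : Fin d) :
    site y (Pi.single ν (L - 1)) + e ν = yplus L y ν := by
  rw [yplus, ← site_add_single, ← Pi.single_add, Nat.sub_add_cancel hL]

/-- [folklore] The block-wise gauge is the identity at every corner reached as `y + Le_ν`, `y ∈ Lℤ^d`. -/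
theorem blockComb_yplus {L : ℕ} (hL : 1 ≤ L) (U₀ U₁ : Cfg d R) {y : Site d} (hy : IsCorner L y) (ν : Fin d) :
    blockComb L U₀ U₁ (yplus L y ν) = 1 := by
  rw [blockComb_of_inBlock hL U₀ U₁ (isCorner_yplus hy ν) (inBlock_self hL _), combGauge_corner]

/-- [folklore] **THE CORNER CROSSING BOND IN THE BLOCK-WISE COMB GAUGE IS A CONJUGATE OF THE COARSE RELATIVE BOND
VARIABLE**: for `y ∈ Lℤ^d`, `(U₁^g)(b₀(y,ν))·U₀(b₀(y,ν))⁻¹ = U₀(Γ)⁻¹·[U₁⁽ᴸ⁾⟨y,ν⟩·U₀⁽ᴸ⁾⟨y,ν⟩⁻¹]·U₀(Γ)`, `Γ = Γ_{y, y+(L−1)e_ν}`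
(pure path algebra: `g = U₀(Γ)⁻¹U₁(Γ)` at the near end, `g = 1` at the far end = the next corner). -/
theorem cornerBond_pert_eq {L : ℕ} (hL : 1 ≤ L) {y : Site d} (hy : IsCorner L y) (U₀ U₁ : Cfg d R) (ν : Fin d) :
    pert U₀ (gaugeAct (blockComb L U₀ U₁) U₁) (site y (Pi.single ν (L - 1))) ν =
      (hol U₀ y (Pi.single ν (L - 1)))⁻¹ * pert (coarse L U₀) (coarse L U₁) y ν * hol U₀ y (Pi.single ν (L - 1)) := by
  simp only [pert, gaugeAct]
  rw [cornerBond_succ hL, blockComb_yplus hL U₀ U₁ hy ν,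
    blockComb_of_inBlock hL U₀ U₁ hy (inBlock_cornerBond_left hL y ν), combGauge_site, relGauge,
    coarse_eq hL U₀, coarse_eq hL U₁]
  group

/-- [folklore] **THE FREE NUMBER IDENTIFIED** (`U₀` unitary-like): `X(y, ν) = ‖(U₁^g)(b₀)·U₀(b₀)⁻¹ − 1‖` EQUALS the
relative deviation of the COARSE bond variables, `‖U₁⁽ᴸ⁾⟨y,ν⟩·U₀⁽ᴸ⁾⟨y,ν⟩⁻¹ − 1‖` (conjugation by the unitary-like `U₀(Γ)`
preserves the distance to `1`, `T4RelativeLadder.norm_conj_sub_one_eq`). -/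
theorem norm_cornerBond_sub_one_eq [NormOneClass R] {U₀ : Cfg d R} (hU₀ : ∀ x ν, UnitaryLike (U₀ x ν)) {L : ℕ}
    (hL : 1 ≤ L) {y : Site d} (hy : IsCorner L y) (U₁ : Cfg d R) (ν : Fin d) :
    ‖(pert U₀ (gaugeAct (blockComb L U₀ U₁) U₁) (site y (Pi.single ν (L - 1))) ν : R) - 1‖ =
      ‖(pert (coarse L U₀) (coarse L U₁) y ν : R) - 1‖ := by
  rw [cornerBond_pert_eq hL hy U₀ U₁ ν, Units.val_mul, Units.val_mul]
  have hu : UnitaryLike (hol U₀ y (Pi.single ν (L - 1)))⁻¹ := (unitaryLike_hol hU₀ y _).inv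
  have h := norm_conj_sub_one_eq hu (pert (coarse L U₀) (coarse L U₁) y ν : R)
  rwa [inv_inv] at h

/-- [folklore] **THE LATTICE BOUND, COARSE FORM**: for a unitary-like pair with global curvature sups `q₁, q₀` whose
COARSE configurations (straight `L`-step transports at the corners) have relative bond deviation `≤ X_c` on `Lℤ^d`,
every bond of `ℤ^d` satisfies `‖(U₁^g)(b)·U₀(b)⁻¹ − 1‖ ≤ crossConst d L·(q₁ + q₀) + X_c` in the block-wise relative comb
gauge — "fine relative deviation ≤ C·(curvatures) + coarse relative deviation". -/
theorem lattice_bound_coarse [NormOneClass R] {U₀ U₁ : Cfg d R} {L : ℕ} {q₁ q₀ Xc : ℝ}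
    (hU₀ : ∀ x ν, UnitaryLike (U₀ x ν)) (hU₁ : ∀ x ν, UnitaryLike (U₁ x ν)) (hL : 1 ≤ L)
    (hq₁ : ∀ x ρ κ, ρ ≠ κ → ‖(plaq U₁ x ρ κ : R) - 1‖ ≤ q₁) (hq₀ : ∀ x ρ κ, ρ ≠ κ → ‖(plaq U₀ x ρ κ : R) - 1‖ ≤ q₀)
    (hq : 0 ≤ q₁ + q₀) (hXc : ∀ y ν, IsCorner L y → ‖(pert (coarse L U₀) (coarse L U₁) y ν : R) - 1‖ ≤ Xc)
    (x : Site d) (ν : Fin d) :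
    ‖(pert U₀ (gaugeAct (blockComb L U₀ U₁) U₁) x ν : R) - 1‖ ≤ crossConst d L * (q₁ + q₀) + Xc :=
  lattice_bound_blockComb hU₀ hU₁ hL hq₁ hq₀ hq
    (fun y ν hy => (norm_cornerBond_sub_one_eq hU₀ hL hy U₁ ν).le.trans (hXc y ν hy)) x ν

/-! ## §4  The lattice bound for FACTORISED (complexified) pairs -/

/-- [folklore] TRANSPORT SIZE of the block-wise gauge: `‖g_x − 1‖ ≤ d(L−1)·ε` when the unitary parts differ by `≤ ε` on the
bonds of the block of `x` (`T4RelativeComb.norm_combGauge_sub_one_le`). -/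
theorem norm_blockComb_sub_one_le [NormOneClass R] {U₀ U₁ : Cfg d R} {L : ℕ} {ε : ℝ}
    (hU₀ : ∀ x ν, UnitaryLike (U₀ x ν)) (hU₁ : ∀ x ν, UnitaryLike (U₁ x ν)) (hL : 1 ≤ L) (hε : 0 ≤ ε)
    (hdev : ∀ x ν, ‖(U₁ x ν : R) - U₀ x ν‖ ≤ ε) (x : Site d) :
    ‖(blockComb L U₀ U₁ x : R) - 1‖ ≤ (d : ℝ) * ((L : ℝ) - 1) * ε :=
  norm_combGauge_sub_one_le hU₀ (fun x' ν' => (hU₁ x' ν').1) hε (fun x' ν' _ _ => hdev x' ν') x (inBlock_corner hL x)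

/-- [folklore] **THE LATTICE BOUND FOR FACTORISED PAIRS** `𝐔ᵢ = Wᵢ ⊙ Uᵢ` (unitary-like parts `Uᵢ` with global curvature
sups `q₁, q₀` and `‖U₁ − U₀‖ ≤ ε` bondwise; complex factors with `‖W₁‖ ≤ n₁`, `‖W₁ − W₀‖ ≤ w`, `‖W₀ − 1‖ ≤ t₀`,
`‖W₀⁻¹‖ ≤ M`): in the block-wise comb gauge `g` OF THE UNITARY PARTS, on every bond of `ℤ^d`,
`‖(𝐔₁^g)(b)·𝐔₀(b)⁻¹ − 1‖ ≤ M·(n₁·(crossConst d L·(q₁ + q₀) + X) + w + 2·d(L−1)ε·t₀)`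
(`T4RelativeCombFactorisedPatch.factorised_bound_gauge` BY NAME; LINEAR, no window cost). -/
theorem factorised_lattice_bound [NormOneClass R] {U₀ U₁ W₀ W₁ : Cfg d R} {L : ℕ} {q₁ q₀ X ε n₁ w t₀ M : ℝ}
    (hU₀ : ∀ x ν, UnitaryLike (U₀ x ν)) (hU₁ : ∀ x ν, UnitaryLike (U₁ x ν)) (hL : 1 ≤ L)
    (hq₁ : ∀ x ρ κ, ρ ≠ κ → ‖(plaq U₁ x ρ κ : R) - 1‖ ≤ q₁) (hq₀ : ∀ x ρ κ, ρ ≠ κ → ‖(plaq U₀ x ρ κ : R) - 1‖ ≤ q₀)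
    (hq : 0 ≤ q₁ + q₀)
    (hX : ∀ y ν, IsCorner L y →
      ‖(pert U₀ (gaugeAct (blockComb L U₀ U₁) U₁) (site y (Pi.single ν (L - 1))) ν : R) - 1‖ ≤ X)
    (hε : 0 ≤ ε) (hdev : ∀ x ν, ‖(U₁ x ν : R) - U₀ x ν‖ ≤ ε)
    (hn₁ : ∀ x ν, ‖(W₁ x ν : R)‖ ≤ n₁) (hw : ∀ x ν, ‖(W₁ x ν : R) - W₀ x ν‖ ≤ w)
    (ht₀ : ∀ x ν, ‖(W₀ x ν : R) - 1‖ ≤ t₀) (hM : ∀ x ν, ‖(((W₀ x ν)⁻¹ : Rˣ) : R)‖ ≤ M) (x : Site d) (ν : Fin d) :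
    ‖(pert (fmul W₀ U₀) (gaugeAct (blockComb L U₀ U₁) (fmul W₁ U₁)) x ν : R) - 1‖ ≤
      M * (n₁ * (crossConst d L * (q₁ + q₀) + X) + w + 2 * ((d : ℝ) * ((L : ℝ) - 1) * ε) * t₀) :=
  factorised_bound_gauge (unitaryLike_blockComb hU₀ hU₁ L x)
    (lattice_bound_blockComb hU₀ hU₁ hL hq₁ hq₀ hq hX x ν) (norm_blockComb_sub_one_le hU₀ hU₁ hL hε hdev x)
    (hn₁ x ν) (hw x ν) (ht₀ x ν) (hM x ν)

/-- [folklore] The same with the free number in COARSE FORM (`norm_cornerBond_sub_one_eq`). -/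
theorem factorised_lattice_bound_coarse [NormOneClass R] {U₀ U₁ W₀ W₁ : Cfg d R} {L : ℕ}
    {q₁ q₀ Xc ε n₁ w t₀ M : ℝ}
    (hU₀ : ∀ x ν, UnitaryLike (U₀ x ν)) (hU₁ : ∀ x ν, UnitaryLike (U₁ x ν)) (hL : 1 ≤ L)
    (hq₁ : ∀ x ρ κ, ρ ≠ κ → ‖(plaq U₁ x ρ κ : R) - 1‖ ≤ q₁) (hq₀ : ∀ x ρ κ, ρ ≠ κ → ‖(plaq U₀ x ρ κ : R) - 1‖ ≤ q₀)
    (hq : 0 ≤ q₁ + q₀) (hXc : ∀ y ν, IsCorner L y → ‖(pert (coarse L U₀) (coarse L U₁) y ν : R) - 1‖ ≤ Xc)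
    (hε : 0 ≤ ε) (hdev : ∀ x ν, ‖(U₁ x ν : R) - U₀ x ν‖ ≤ ε)
    (hn₁ : ∀ x ν, ‖(W₁ x ν : R)‖ ≤ n₁) (hw : ∀ x ν, ‖(W₁ x ν : R) - W₀ x ν‖ ≤ w)
    (ht₀ : ∀ x ν, ‖(W₀ x ν : R) - 1‖ ≤ t₀) (hM : ∀ x ν, ‖(((W₀ x ν)⁻¹ : Rˣ) : R)‖ ≤ M) (x : Site d) (ν : Fin d) :
    ‖(pert (fmul W₀ U₀) (gaugeAct (blockComb L U₀ U₁) (fmul W₁ U₁)) x ν : R) - 1‖ ≤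
      M * (n₁ * (crossConst d L * (q₁ + q₀) + Xc) + w + 2 * ((d : ℝ) * ((L : ℝ) - 1) * ε) * t₀) :=
  factorised_lattice_bound hU₀ hU₁ hL hq₁ hq₀ hq
    (fun y ν hy => (norm_cornerBond_sub_one_eq hU₀ hL hy U₁ ν).le.trans (hXc y ν hy)) hε hdev hn₁ hw ht₀ hM x ν

/-! ## §5  Non-vacuity -/

/-- Non-vacuity of §1: in `ℤ¹` with `L = 3`, the corner of `−1` is `−3` and that of `5` is `3`. -/
example : corner 3 (fun _ : Fin 1 => (-1 : ℤ)) = fun _ => -3 := by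
  funext i; simp [corner]

example : corner 3 (fun _ : Fin 1 => (5 : ℤ)) = fun _ => 3 := by
  funext i; simp [corner]

/-- Non-vacuity of §3 (over `ℝ`, any `d`, `L = 2`): for the flat pair `U₀ = U₁ = 1` the hypotheses of
`lattice_bound_blockComb` hold with `q₁ = q₀ = 0` and the universal `X = 2` (a relative bond variable of a unitary-like
pair is unitary-like, hence within `2` of `1`), and the conclusion reads `… ≤ crossConst d 2·0 + 2`. -/
example (x : Site d) (ν : Fin d) :
    ‖(pert (1 : Cfg d ℝ) (gaugeAct (blockComb 2 (1 : Cfg d ℝ) 1) 1) x ν : ℝ) - 1‖ ≤ crossConst d 2 * (0 + 0) + 2 := by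
  have hU : ∀ (x : Site d) (ν : Fin d), UnitaryLike ((1 : Cfg d ℝ) x ν) := fun _ _ => by
    simpa using (UnitaryLike.one : UnitaryLike (1 : ℝˣ))
  refine lattice_bound_blockComb hU hU (by norm_num) ?_ ?_ (by norm_num) ?_ x ν
  · intro x ρ κ _; simp [plaq]
  · intro x ρ κ _; simp [plaq]
  · intro y ν _
    exact T4RelativeCombWindow.norm_sub_one_le_two_of_unitaryLike
      (T4RelativeCombCrossing.unitaryLike_pert hU
        (T4RelativeComb.unitaryLike_gaugeAct (unitaryLike_blockComb hU hU 2) hU) _ _)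

/-- At scale `L = 1` the coarse configuration is the configuration itself. -/
example (U : Cfg d ℝ) (y : Site d) (ν : Fin d) : coarse 1 U y ν = U y ν := by
  have h0 : site y (0 : Fin d → ℕ) = y := by funext κ; simp [site]
  rw [coarse_eq le_rfl]
  simp [T4RelativeComb.hol_zero, h0]

end Literature.MathematicalPhysics.QuantumFieldTheory.Balaban1983to89.T4BlockwiseCombGauge
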